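import Mathlib

/-!
# Antisymmetric double sums over a finite set vanish

Pure finite-sum algebra used in the one-step drift computation of `q`
(the `p`-redistribution term cancels): for a symmetric kernel `θ`,

`∑ z ∈ P, w z * ∑ y ∈ P.erase z, w y * θ y z * (g y - g z) = 0`.

The summand `F (y, z) := w z * w y * θ y z * (g y - g z)` over ordered pairs is
antisymmetric under swapping `y` and `z`, so the double sum equals its own negative.
-/

open scoped BigOperators

namespace Summit.MatrixMultiplication.MatrixMultiplication.Theorems

set_option linter.dupNamespace false in
/-- Antisymmetric double sums over a finite set vanish: for a symmetric kernel `θ`,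
`∑ z ∈ P, w z * ∑ y ∈ P.erase z, w y * θ y z * (g y - g z) = 0`.  The diagonal term is
zero, so `P.erase z` may be replaced by `P`; swapping the order of summation and using the
symmetry of `θ` shows the sum equals its own negative. -/
theorem sum_mul_sum_erase_antisymm_eq_zero : ∀ {α : Type*} [DecidableEq α] (P : Finset α) (w g : α → ℝ) (θ : α → α → ℝ),
    (∀ a b, θ a b = θ b a) →
      ∑ z ∈ P, w z * ∑ y ∈ P.erase z, w y * θ y z * (g y - g z) = 0 := by
  intro α _ P w g θ hθ
  -- the diagonal term vanishes, so the `erase` can be dropped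
  have h1 : ∀ z, ∑ y ∈ P.erase z, w y * θ y z * (g y - g z) =
      ∑ y ∈ P, w y * θ y z * (g y - g z) := fun z =>
    Finset.sum_erase P (by rw [sub_self, mul_zero])
  simp_rw [h1, Finset.mul_sum]
  -- swap the order of summation
  have h2 : ∑ z ∈ P, ∑ y ∈ P, w z * (w y * θ y z * (g y - g z)) =
      ∑ z ∈ P, ∑ y ∈ P, w y * (w z * θ z y * (g z - g y)) := Finset.sum_comm
  -- the sum plus its swapped version vanishes termwise, by symmetry of `θ`
  have h3 : ∑ z ∈ P, ∑ y ∈ P, w z * (w y * θ y z * (g y - g z)) +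
      ∑ z ∈ P, ∑ y ∈ P, w y * (w z * θ z y * (g z - g y)) = 0 := by
    rw [← Finset.sum_add_distrib]
    refine Finset.sum_eq_zero fun z _ => ?_
    rw [← Finset.sum_add_distrib]
    refine Finset.sum_eq_zero fun y _ => ?_
    rw [hθ y z]
    ring
  linarith
end Summit.MatrixMultiplication.MatrixMultiplication.Theorems
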